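import Literature.NumberTheory.EllipticCurves.CanonicalPAdicHeightParallelogramProofs
import Literature.NumberTheory.EllipticCurves.LocalDenominatorLaw
import Literature.NumberTheory.EllipticCurves.GoodReductionInertia
import HarnessLib

/-!
# The canonical `p`-adic height: discharge of the two arithmetic leaves
# (`padicValNat_den_parallelogram`, `not_isOfFinAddOrder_of_one_lt_padicNorm`)

Trunk T-NT-EC (Literature/NumberTheory/EllipticCurves); third proof file behind the named fact
`WeierstrassCurve.exists_isCanonical` (`CanonicalPAdicHeight.lean`). After
`CanonicalPAdicHeightProofs.lean` (algebraic skeleton) and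
`CanonicalPAdicHeightParallelogramProofs.lean` (admissible locus, `σ_p ≠ 0`, parallelogram law from
the theta relation), the existence of the canonical datum rested on four named facts. This file
PROVES two of them:

* `padicValNat_den_parallelogram_holds` — Néron's quasi-parallelogram law at every prime in
  denominator form (Silverman ATAEC VI.4.1 + Ex. 6.3), as the `ℚ`-specialisation of the generic
  law `max_v_addX_mul_max_v_addX_neg_mul_v_sub_sq` of `LocalDenominatorLaw.lean` (valuation ring
  `ℤ_(ℓ) ⊂ ℚ`, local model `W.localModel ℓ`), read through `max(1, ‖x‖_ℓ) = ℓ^{ord_ℓ(den x)}`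
  (`max_one_norm_ratCast`);
* `not_isOfFinAddOrder_of_one_lt_padicNorm_holds` — `E(ℚ) ∩ E₁(ℚ_p)` is torsion-free for `p` odd
  (AEC VII.3.4 / IV.6.1 over `ℚ_p`), by DIVISION POLYNOMIALS instead of the formal group: a
  torsion point of `E₁` has a multiple `R = (x', y') ∈ E₁` of prime order `q`; for `q ≠ p` this
  contradicts `val_le_one_of_zsmul_eq_zero` (`GoodReductionInertia.lean`: `ΨSq_q(x') = 0` but its
  leading coefficient `q²` is a `p`-adic unit); for `q = p` (odd) `ψ_p(x') = 0` with
  `ψ_p = p·x^{(p²-1)/2} + (p-integral lower terms)` univariate (Mathlib `preΨ'`, `coeff_preΨ'`,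
  `natDegree_preΨ'_le`), whose leading term dominates since `‖x'‖_p ≥ p²`
  (`sq_le_norm_of_one_lt_norm`: `3 ord x = 2 ord y`) — `val_eval_eq_mul_pow`;

and assembles `exists_isCanonical_of_padicSigma_theta`:

  `exists_isCanonical ⟸ padicSigma_theta` (Mazur–Tate 1991, Thm. 3.1 / Blakestad–Grant 2023,
  Prop. 14: the theta relation `σ(u+v)σ(u-v)/(σ(u)²σ(v)²) = x(v) - x(u)` of the Mazur–Tate sigma
  function on the kernel of reduction),

the ONE remaining named fact behind the existence of the canonical `p`-adic height (it
presupposes the existence of the Mazur–Tate pair, `mazur_tate_sigma_existsUnique`, and the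
identification `E₁(ℚ_p) ≅ Ê(pℤ_p)`). Nothing is asserted here.

## Sources

* J. H. Silverman, *ATAEC* (1994), Thm. VI.4.1, Ex. 6.3; *AEC* 2nd ed. (2009), VII.2.1–2.2,
  VII.3.1, VII.3.4, IV.6.1 (statements), Exercise 3.7 (division polynomials).
* B. Mazur, W. Stein, J. Tate, Doc. Math. Extra Vol. Coates (2006), §1, §2.4–2.7.

## Design notes

* The generic files are elaborated with the classical `DecidableEq` instance; the statement of
  the named facts uses `Rat`'s. The `ℤ`-multiples and the chord slope are aligned by
  `point_zsmul_irrel` (`Subsingleton.elim`) and by rewriting `slope` to the explicit quotient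
  (`slope_of_X_ne`); the `CommRing ℚ` instance inside `negY` is aligned by `rfl`.
* `val_eval_eq_mul_pow` is the non-unit-leading-coefficient variant of
  `Literature.NumberTheory.EllipticCurves.val_eval_eq_pow`.
-/

noncomputable section

open scoped Classical NNReal

namespace Literature.NumberTheory.EllipticCurves

open Polynomial

/-- **Dominant leading term, non-unit leading coefficient.** If `q ∈ L[X]` has `w`-integral
coefficients and degree `≤ d`, and `w(q_d) · w(x) > 1` with `w x ≥ 1`, then
`w(q(x)) = w(q_d) · w(x)^d` (in particular `q(x) ≠ 0`). [folklore] -/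
theorem val_eval_eq_mul_pow {L : Type*} [Field L] {w : Valuation L ℝ≥0} {q : L[X]} {d : ℕ}
    (hq : ∀ i, w (q.coeff i) ≤ 1) (hd : q.natDegree ≤ d) {x : L} (hx1 : 1 ≤ w x)
    (hx : 1 < w (q.coeff d) * w x) : w (q.eval x) = w (q.coeff d) * w x ^ d := by
  have htop : w (q.coeff d * x ^ d) = w (q.coeff d) * w x ^ d := by rw [map_mul, map_pow]
  have hx0 : w x ≠ 0 := (zero_lt_one.trans_le hx1).ne'
  have hc0 : w (q.coeff d) ≠ 0 := by
    rintro h; rw [h, zero_mul] at hx; exact not_lt_of_ge zero_le_one hx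
  rw [eval_eq_sum_range' (Nat.lt_succ_of_le hd), Finset.sum_range_succ,
    Valuation.map_add_eq_of_lt_right]
  · exact htop
  · rw [htop]
    refine Valuation.map_sum_lt _ (mul_ne_zero hc0 (pow_ne_zero _ hx0)) fun i hi ↦ ?_
    rw [Finset.mem_range] at hi
    obtain ⟨d', rfl⟩ : ∃ d', d = d' + 1 := ⟨d - 1, by omega⟩
    rw [map_mul, map_pow]
    calc w (q.coeff i) * w x ^ i ≤ 1 * w x ^ d' :=
          mul_le_mul' (hq i) (pow_le_pow_right₀ hx1 (by omega))
      _ < (w (q.coeff (d' + 1)) * w x) * w x ^ d' := by gcongr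
      _ = w (q.coeff (d' + 1)) * w x ^ (d' + 1) := by ring

/-- Decidability-irrelevance of `ℤ`-multiples of points (companion of `point_add_irrel`): the
`AddCommGroup` structure on `V.toAffine.Point` takes a `DecidableEq` instance; any two give the
same multiples. [folklore] -/
theorem point_zsmul_irrel {F : Type*} [Field F] {V : WeierstrassCurve F} (d₁ d₂ : DecidableEq F)
    (n : ℤ) (P : V.toAffine.Point) :
    @HSMul.hSMul ℤ _ _ (@instHSMul ℤ _ (@ZSMul.toSMul _ (@SubNegMonoid.toZSMul _ (@AddGroup.toSubNegMonoid _
      (@AddCommGroup.toAddGroup _ (@WeierstrassCurve.Affine.Point.instAddCommGroup F _ V.toAffine d₁)))))) n P =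
    @HSMul.hSMul ℤ _ _ (@instHSMul ℤ _ (@ZSMul.toSMul _ (@SubNegMonoid.toZSMul _ (@AddGroup.toSubNegMonoid _
      (@AddCommGroup.toAddGroup _ (@WeierstrassCurve.Affine.Point.instAddCommGroup F _ V.toAffine d₂)))))) n P := by
  have : d₁ = d₂ := Subsingleton.elim _ _
  subst this; rfl

end Literature.NumberTheory.EllipticCurves

namespace WeierstrassCurve

open Literature.NumberTheory.EllipticCurves

section DenQ

variable (ℓ : ℕ) [Fact ℓ.Prime]

/-- **The local denominator as a norm**: `max(1, ‖x‖_ℓ) = ℓ ^ ord_ℓ(den x)` for `x ∈ ℚ` (numerator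
and denominator are coprime). [folklore] -/
theorem max_one_norm_ratCast (x : ℚ) :
    max 1 ‖(x : ℚ_[ℓ])‖ = (ℓ : ℝ) ^ (padicValNat ℓ x.den : ℤ) := by
  have hp := (Fact.out : ℓ.Prime)
  have hp1 : (1 : ℝ) < ℓ := by exact_mod_cast hp.one_lt
  rcases eq_or_ne x 0 with rfl | hx
  · simp
  · have hnorm : ‖(x : ℚ_[ℓ])‖ = (ℓ : ℝ) ^ (-padicValRat ℓ x) := by
      rw [Padic.eq_padicNorm, padicNorm.eq_zpow_of_nonzero hx]; push_cast; rfl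
    have hval : padicValRat ℓ x = (padicValNat ℓ x.num.natAbs : ℤ) - padicValNat ℓ x.den := by
      rw [padicValRat_def]; simp [padicValInt]
    have hcop : padicValNat ℓ x.num.natAbs = 0 ∨ padicValNat ℓ x.den = 0 := by
      by_contra h
      rw [not_or] at h
      have h1 : ℓ ∣ x.num.natAbs := dvd_of_one_le_padicValNat (Nat.pos_of_ne_zero h.1)
      have h2 : ℓ ∣ x.den := dvd_of_one_le_padicValNat (Nat.pos_of_ne_zero h.2)
      exact hp.one_lt.ne' (Nat.Coprime.eq_one_of_dvd (Nat.Coprime.coprime_dvd_left h1 x.reduced) h2)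
    rcases hcop with h0 | h0
    · rw [hnorm, hval, h0, Nat.cast_zero, zero_sub, neg_neg]
      exact max_eq_right (one_le_zpow₀ hp1.le (by positivity))
    · rw [h0, Nat.cast_zero, zpow_zero, hnorm, hval, h0, Nat.cast_zero, sub_zero]
      exact max_eq_left (zpow_le_one_of_nonpos₀ hp1.le (by simp))

/-- `‖q‖_ℓ = ℓ ^ (-ord_ℓ q)` for `q ≠ 0`. [folklore] -/
theorem norm_ratCast_eq_zpow {q : ℚ} (hq : q ≠ 0) :
    ‖(q : ℚ_[ℓ])‖ = (ℓ : ℝ) ^ (-padicValRat ℓ q) := by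
  rw [Padic.eq_padicNorm, padicNorm.eq_zpow_of_nonzero hq]; push_cast; rfl

/-- **Discharge of `padicValNat_den_parallelogram`** (Néron's quasi-parallelogram law at a prime
of non-singular reduction, denominator form, Silverman ATAEC VI.4.1 + Ex. 6.3): the generic law
`max_v_addX_mul_max_v_addX_neg_mul_v_sub_sq` of `LocalDenominatorLaw.lean` for the local model
of `W` over `ℤ_(ℓ)` and the `ℓ`-adic absolute value of `ℚ`, read through
`max(1, ‖x‖_ℓ) = ℓ^{ord_ℓ(den x)}`. [Silverman ATAEC VI.4.1, Ex. 6.3; Silverman AEC VII.2.1]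
[cite: SilvermanATAEC1994, VI.4.1 and Ex. 6.3] -/
theorem padicValNat_den_parallelogram_holds : padicValNat_den_parallelogram := by
  intro W _ _ ℓ _ x₁ y₁ x₂ y₂ h₁ h₂ hx hn₁ hn₂ _ _
  have hp := (Fact.out : ℓ.Prime)
  have hv := integers_localIntegers ℓ
  have h₁' : ((W.localModel ℓ).baseChange ℚ).toAffine.Nonsingular x₁ y₁ := h₁
  have h₂' : ((W.localModel ℓ).baseChange ℚ).toAffine.Nonsingular x₂ y₂ := h₂
  have hP : HasNonsingularReduction (K := ℚ) (W.localModel ℓ) (.some x₁ y₁ h₁') :=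
    (hasNonsingularReduction_localModel_iff h₁).mpr hn₁
  have hQ : HasNonsingularReduction (K := ℚ) (W.localModel ℓ) (.some x₂ y₂ h₂') :=
    (hasNonsingularReduction_localModel_iff h₂).mpr hn₂
  have key := max_v_addX_mul_max_v_addX_neg_mul_v_sub_sq hv h₁' h₂' hx hP hQ
  rw [baseChange_localModel] at key
  rw [@WeierstrassCurve.Affine.slope_of_X_ne ℚ _ W.toAffine (fun a b => Classical.propDecidable (a = b))
      _ _ _ _ hx, @WeierstrassCurve.Affine.slope_of_X_ne ℚ _ W.toAffine
      (fun a b => Classical.propDecidable (a = b)) _ _ _ _ hx] at key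
  simp only [ratAdicValuation_apply] at key
  have key' := congrArg (fun t : NNReal => (t : ℝ)) key
  simp only [NNReal.coe_mul, NNReal.coe_pow, NNReal.coe_max, NNReal.coe_one, coe_nnnorm] at key'
  rw [max_one_norm_ratCast, max_one_norm_ratCast, max_one_norm_ratCast, max_one_norm_ratCast,
    norm_ratCast_eq_zpow ℓ (sub_ne_zero.mpr hx)] at key'
  -- the statement, on the chord formulas (the `CommRing ℚ` instance inside `negY` is aligned with
  -- the one coming from the generic, `Field`-based, theorem)
  rw [WeierstrassCurve.Affine.Point.add_of_X_ne hx, sub_eq_add_neg,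
    WeierstrassCurve.Affine.Point.neg_some, WeierstrassCurve.Affine.Point.add_of_X_ne hx,
    xCoord_some, xCoord_some,
    show @WeierstrassCurve.Affine.negY ℚ Rat.commRing W.toAffine x₂ y₂ =
      @WeierstrassCurve.Affine.negY ℚ (@Field.toCommRing ℚ _) W.toAffine x₂ y₂ from rfl,
    WeierstrassCurve.Affine.slope_of_X_ne hx, WeierstrassCurve.Affine.slope_of_X_ne hx]
  -- compare exponents
  have hℓ0 : (ℓ : ℝ) ≠ 0 := by exact_mod_cast hp.ne_zero
  have hℓ1 : (1 : ℝ) < ℓ := by exact_mod_cast hp.one_lt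
  rw [← zpow_natCast, ← zpow_natCast, ← zpow_natCast, ← zpow_mul, ← zpow_mul, ← zpow_mul,
    ← zpow_add₀ hℓ0, ← zpow_add₀ hℓ0, ← zpow_add₀ hℓ0] at key'
  have := zpow_right_injective₀ (zero_lt_one.trans hℓ1) hℓ1.ne' key'
  simp only [Nat.cast_ofNat] at this
  omega

end DenQ


/-! ### `E₁(ℚ_p) ∩ E(ℚ)` is torsion-free for `p` odd (division polynomials) -/

section Torsion

open Polynomial

variable (p : ℕ) [Fact p.Prime]

variable (W : WeierstrassCurve ℚ) [W.IsIntegral ℤ]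

/-- A `ℤ`-integral equation is integral for the `p`-adic valuation ring of `ℚ` (Mathlib's
`IsIntegral (ratAdicValuation p).integer`, the hypothesis of `GoodReductionInertia.lean`).
[folklore] -/
theorem isIntegral_integer_ratAdicValuation : W.IsIntegral (ratAdicValuation p).integer :=
  ⟨⟨⟨W.a₁, W.a₁_mem_localIntegers p⟩, ⟨W.a₂, W.a₂_mem_localIntegers p⟩,
    ⟨W.a₃, W.a₃_mem_localIntegers p⟩, ⟨W.a₄, W.a₄_mem_localIntegers p⟩,
    ⟨W.a₆, W.a₆_mem_localIntegers p⟩⟩, rfl⟩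

variable {p W} in
/-- **A rational point of `E₁(ℚ_p)` has `‖x‖_p ≥ p²`** (`3 ord(x) = 2 ord(y)`, so `ord x` is even
and negative). [Silverman AEC VII.2.2 (`3v(x) = 2v(y)`)] [folklore] -/
theorem sq_le_norm_of_one_lt_norm {x y : ℚ} (h : W.toAffine.Nonsingular x y)
    (hx : 1 < ‖(x : ℚ_[p])‖) : (p : ℝ) ^ 2 ≤ ‖(x : ℚ_[p])‖ := by
  have hv := integers_localIntegers p
  have h1 : ((W.localModel p).baseChange ℚ).toAffine.Equation x y := h.1
  have hx' : 1 < ratAdicValuation p x := by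
    rw [ratAdicValuation_apply, ← NNReal.coe_lt_coe, NNReal.coe_one, coe_nnnorm]; exact hx
  obtain ⟨hxy, hsq⟩ := Literature.NumberTheory.EllipticCurves.v_X_lt_v_Y_of_one_lt hv h1 hx'
  have hsq' : ‖(y : ℚ_[p])‖ ^ 2 = ‖(x : ℚ_[p])‖ ^ 3 := by
    have := congrArg (fun t : NNReal => (t : ℝ)) hsq
    simpa only [ratAdicValuation_apply, NNReal.coe_pow, coe_nnnorm] using this
  have hx0 : (x : ℚ_[p]) ≠ 0 := by
    rintro h0; rw [h0, norm_zero] at hx; exact not_lt.mpr zero_le_one hx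
  have hy0 : (y : ℚ_[p]) ≠ 0 := by
    rintro h0; rw [h0, norm_zero, zero_pow two_ne_zero] at hsq'
    exact pow_ne_zero 3 (norm_ne_zero_iff.mpr hx0) hsq'.symm
  have hp1 : (1 : ℝ) < p := by exact_mod_cast (Fact.out : p.Prime).one_lt
  rw [Padic.norm_eq_zpow_neg_valuation hx0] at hx hsq' ⊢
  rw [Padic.norm_eq_zpow_neg_valuation hy0, ← zpow_natCast, ← zpow_natCast, ← zpow_mul,
    ← zpow_mul] at hsq'
  have hexp := zpow_right_injective₀ (zero_lt_one.trans hp1) hp1.ne' hsq'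
  have hneg : 0 < -(x : ℚ_[p]).valuation := (one_lt_zpow_iff_right₀ hp1).mp hx
  rw [← zpow_natCast]
  exact zpow_le_zpow_right₀ hp1.le (by push_cast at hexp ⊢; omega)

/-- **Discharge of `not_isOfFinAddOrder_of_one_lt_padicNorm`: `E₁(ℚ_p) ∩ E(ℚ)` has no torsion
for `p` odd** (AEC IV.6.1/VII.3.4 for `ℚ_p`), by division polynomials instead of the formal group:
if `P ∈ E(ℚ) ∩ E₁(ℚ_p)` had finite order, some multiple `R = (x', y')` of it (again in `E₁`,
a subgroup) would have prime order `q`; for `q ≠ p` this contradicts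
`val_le_one_of_zsmul_eq_zero` (`ΨSq_q` has unit leading coefficient), and for `q = p` one has
`ψ_p(R) = 0` with `ψ_p = p x^{(p²-1)/2} + (integral lower terms)` univariate (`p` odd), whose
leading term dominates because `‖x'‖_p ≥ p²` (`sq_le_norm_of_one_lt_norm`).
[Silverman AEC VII.3.4, IV.6.1 (statement); Exercise 3.7 (method)]
[cite: SilvermanAEC2009, VII.3.4] -/
theorem not_isOfFinAddOrder_of_one_lt_padicNorm_holds : not_isOfFinAddOrder_of_one_lt_padicNorm := by
  intro W _ _ p _ hp x y h hx hfin
  haveI : W.IsIntegral (ratAdicValuation p).integer := W.isIntegral_integer_ratAdicValuation p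
  have hprime : p.Prime := Fact.out
  -- a multiple of prime order, still in `E₁`
  set P : W.toAffine.Point := .some x y h with hPdef
  have hN : 0 < addOrderOf P := hfin.addOrderOf_pos
  have hN1 : addOrderOf P ≠ 1 := by
    rw [Ne, AddMonoid.addOrderOf_eq_one_iff]; exact WeierstrassCurve.Affine.Point.some_ne_zero h
  obtain ⟨q, hq, hqN⟩ := Nat.exists_prime_and_dvd hN1
  obtain ⟨m, hm⟩ := hqN
  have hm0 : m ≠ 0 := by rintro rfl; rw [mul_zero] at hm; omega
  have hmlt : m < addOrderOf P := by
    rw [hm]; exact lt_mul_left (Nat.pos_of_ne_zero hm0) hq.one_lt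
  set R := m • P with hRdef
  have hR0 : R ≠ 0 := nsmul_ne_zero_of_lt_addOrderOf hm0 hmlt
  have hqR : q • R = 0 := by
    rw [hRdef, ← mul_nsmul, Nat.mul_comm m q, ← hm]; exact addOrderOf_nsmul_eq_zero P
  have hRmem : R ∈ W.kernelOfReductionAt p :=
    AddSubgroup.nsmul_mem _ ((some_mem_kernelOfReductionAt_iff h).mpr hx) m
  rcases hR : R with _ | ⟨x', y', h'⟩
  · exact hR0 hR
  rw [hR] at hRmem hqR
  have hx' : 1 < ‖(x' : ℚ_[p])‖ := (some_mem_kernelOfReductionAt_iff h').mp hRmem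
  have hqR' : (q : ℤ) • (.some x' y' h' : W.toAffine.Point) = 0 := by rw [natCast_zsmul]; exact hqR
  -- the same multiple for the classical `DecidableEq ℚ` instance of the generic files
  have hqR'' := (point_zsmul_irrel (instDecidableEqRat) (fun a b => Classical.propDecidable (a = b))
    (q : ℤ) (.some x' y' h' : W.toAffine.Point)).symm.trans hqR'
  by_cases hqp : q = p
  · -- `q = p`: `ψ_p(x') = 0`, impossible by dominance of `p x'^{(p²-1)/2}`
    subst hqp
    have hΨ : (W.ΨSq q).eval x' = 0 := (W.zsmul_some_eq_zero_iff_eval_ΨSq h' q).mp hqR''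
    have hodd : ¬ Even q := fun he => by
      have := hq.even_iff.mp he; omega
    rw [WeierstrassCurve.ΨSq_ofNat, if_neg hodd, mul_one, eval_pow, pow_eq_zero_iff two_ne_zero] at hΨ
    -- integrality, degree and leading coefficient of `preΨ' q`
    set d := (q ^ 2 - 1) / 2 with hd
    have hdeg : (W.preΨ' q).natDegree ≤ d := by
      have := W.natDegree_preΨ'_le q; rwa [if_neg hodd] at this
    have hlead : (W.preΨ' q).coeff d = q := by
      have := W.coeff_preΨ' q; rw [if_neg hodd, if_neg hodd] at this; exact this
    have hcoeff : ∀ i, ratAdicValuation q ((W.preΨ' q).coeff i) ≤ 1 := fun i => by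
      have hmap : W.preΨ' q = ((W.integralModel ℤ).preΨ' q).map (algebraMap ℤ ℚ) := by
        rw [← WeierstrassCurve.map_preΨ', ← WeierstrassCurve.baseChange,
          WeierstrassCurve.baseChange_integralModel_eq]
      rw [hmap, coeff_map, ratAdicValuation_apply, ← NNReal.coe_le_coe, NNReal.coe_one, coe_nnnorm,
        eq_intCast, Rat.cast_intCast]
      exact Padic.norm_int_le_one _
    have hx1 : 1 ≤ ratAdicValuation q x' := by
      rw [ratAdicValuation_apply, ← NNReal.coe_le_coe, NNReal.coe_one, coe_nnnorm]; exact hx'.le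
    have hdom : 1 < ratAdicValuation q ((W.preΨ' q).coeff d) * ratAdicValuation q x' := by
      rw [hlead, ratAdicValuation_apply, ratAdicValuation_apply, ← NNReal.coe_lt_coe, NNReal.coe_one,
        NNReal.coe_mul, coe_nnnorm, coe_nnnorm, Rat.cast_natCast, Padic.norm_p]
      have hp0 : (0 : ℝ) < q := by exact_mod_cast hq.pos
      have h2q : (2 : ℝ) ≤ q := by exact_mod_cast hq.two_le
      have h2 := sq_le_norm_of_one_lt_norm h' hx'
      rw [inv_mul_eq_div, lt_div_iff₀ hp0, one_mul]
      nlinarith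
    have hval := val_eval_eq_mul_pow hcoeff hdeg hx1 hdom
    rw [hΨ, map_zero] at hval
    have hc : 0 < ratAdicValuation q ((W.preΨ' q).coeff d) := by
      refine pos_of_ne_zero fun h0 => ?_
      rw [h0, zero_mul] at hdom
      exact not_lt_of_ge zero_le_one hdom
    exact (mul_pos hc (pow_pos (zero_lt_one.trans_le hx1) d)).ne hval
  · -- `q ≠ p`: `ΨSq_q` has unit leading coefficient (`val_le_one_of_zsmul_eq_zero`)
    have hwq : ratAdicValuation p ((q : ℤ) : ℚ) = 1 := by
      rw [ratAdicValuation_apply, ← NNReal.coe_eq_one, coe_nnnorm, Int.cast_natCast, Rat.cast_natCast,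
        Padic.norm_natCast_eq_one_iff]
      exact (Nat.coprime_primes hprime hq).mpr (Ne.symm hqp)
    have := Literature.NumberTheory.EllipticCurves.val_le_one_of_zsmul_eq_zero (V := W) hwq hqR''
    rw [ratAdicValuation_apply, ← NNReal.coe_le_coe, NNReal.coe_one, coe_nnnorm] at this
    exact absurd hx' (not_lt.mpr this)

end Torsion

/-! ### Assembly: one named fact left -/

/-- **Existence of the canonical `p`-adic height datum from the theta relation alone.** For
`E/ℚ` with globally minimal `W` and `p ≥ 5` good ordinary, the sigma formula
`ĥ_p(P) = log_p(den x(P)) - 2 log_p σ_p(z(P))` is the quadratic form, on admissible points, of a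
symmetric bilinear torsion-vanishing pairing `E(ℚ) × E(ℚ) → ℚ_p` — GIVEN the theta relation of the
Mazur–Tate sigma function (`padicSigma_theta`); every other input of the printed argument
(MST 2006 §1, §2.6–2.7) is now a theorem of the tree: torsion-freeness of `E₁(ℚ_p)` and Néron's
denominator law (this file), `log_p` multiplicativity (`PAdicHeightsLogProofs`), the admissible
subgroup, `σ_p ≠ 0` and the parallelogram step (`CanonicalPAdicHeightParallelogramProofs`), the
algebraic half (`CanonicalPAdicHeightProofs`). [Mazur–Stein–Tate 2006, §1, §2.6–2.7;
Stein–Wuthrich 2013, §4.1 eq. (4.1)] [cite: MazurSteinTate2006, §2.7] -/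
theorem exists_isCanonical_of_padicSigma_theta (hθ : padicSigma_theta) : exists_isCanonical :=
  exists_isCanonical_of_theta not_isOfFinAddOrder_of_one_lt_padicNorm_holds hθ
    padicValNat_den_parallelogram_holds

/-- The same with uniqueness, given admissible multiples (`exists_admissible_nsmul`).
[Mazur–Stein–Tate 2006, §1 ("extends uniquely")] [folklore] -/
theorem existsUnique_isCanonical_of_padicSigma_theta (hθ : padicSigma_theta)
    (hS : exists_admissible_nsmul) (W : WeierstrassCurve ℚ) [W.IsElliptic] [W.IsGloballyMinimal]
    (p : ℕ) [Fact p.Prime] (hp : 5 ≤ p) (hgood : W.HasGoodReductionAtPrime p)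
    (hord : ¬ (p : ℤ) ∣ W.frobeniusTrace p) : ∃! D : PAdicHeightData W p, D.IsCanonical :=
  existsUnique_isCanonical_of_theta not_isOfFinAddOrder_of_one_lt_padicNorm_holds hθ
    padicValNat_den_parallelogram_holds hS W p hp hgood hord

end WeierstrassCurve
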